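import Summits.QuantumFields.YangMills.Theorems.FluctuationComparisonRegPrIntLS2BetaCaseBTransportPointwise
import Summits.QuantumFields.YangMills.Theorems.FluctuationComparisonRegPrIntLS2BetaWindowStrataCaseB
import Literature.MathematicalPhysics.QuantumFieldTheory.Balaban1983to89.T3Thresholds
import Literature.MathematicalPhysics.QuantumFieldTheory.Balaban1983to89.T3DescentFibreTower
import HarnessLib

/-!
# (RG-K) THE ℤ₂ SEAM TWIST, XI — THE REGISTERED ORGAN GAP♯∘ (`UniformFibreGapOrbit` of LINE S2β, v11.4 text, `∃ μ` BEFORE `∀ F γ J K V U₀`) FOLLOWS FROM ITS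
# RESTRICTIONS TO THE TWO ANALYTIC STRATA (irreducible data; gauge-abelian data of case A) AND ITS BODY AT THE SINGLE FLAT DATUM `(V, U₀) = (1, 1)`:
# the whole case-B stratum costs exactly one volume-uniform constant at `(1, 1)`

Helper for crux `stmt-QuantumFields-20520` (`Theses.UnitScaleTilt.FluctuationComparisonRegPrIntL`), the (T)-chain of LINE `semiclassical_s2beta` (cell
`ym3-torus`, width seat «width 16» px16 g19).  Part IX (✓`…S2BetaWindowExactnessOfStrata`) reduced the registered EXW∘ to its irreducible and case-A strata
(case B is free: the regular minimum vanishes there).  For the STIFFNESS organ GAP♯∘ the case-B stratum is NOT free — it carries the quadratic growth of the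
Wilson action about the residual orbit of the flat representative — but part X (✓`…S2BetaCaseBTransportPointwise.gapFlatAt_caseB_of_flat`) transports that
growth, POINTWISE in `(F, γ, b₀, p₀, J, K, ε₀)` and with the SAME constant, from `(1, 1)` to every case-B datum and every R2-critical base point.  Hence the
registered text (whose `μ` is chosen before the family, the coupling, the run and the datum) follows from: the same text on irreducible data, the same text
on case-A data, and ONE flat-datum supplier «`∃ μ(L, b₀, p₀, ε₀) > 0` before `∀ F γ J K`, GAP-body at `(1, 1)`» — the shape px12 g22's volume-uniform
programme produces (✓p810135 ∕ ✓p810242 local kinematics; depth one signed as `…S2BetaFlatTubeDepthOneUniform.tubeGrowth_flat_depthOne_uniform`).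

* §1 ★ `mem_regFibrePr_of_eq_min_caseB` — at a case-B `2`-small datum a fibre point whose action equals the regular minimum is FLAT (✓part VII
  `minActionRegPr_eq_zero_of_loopHol_central`), hence a member of (6)(ε₀) (✓`regPr_of_flat`); ★★★★ `gapFlatAt_caseB_of_flat_atArgmin` — part X's pointwise
  transport keyed on the REGISTRY's base-point binder (`U₀ ∈ fibre V`, `A(U₀) = minActionRegPr ε₀ V`; R2-criticality by ✓`isCritR2_of_eq_minActionRegPr`).
* §2 `gapAt_depthZero` — at depth `K − J = 0` the GAP-body is trivial at EVERY datum (`fibre_{K,K}(V) = {V}`, lit ✓`fibre_self`; the orbit functional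
  vanishes at `w ≡ 1`).
* §3 ★★★★ `uniformFibreGapOrbit_of_strata_of_flat (hIrr) (hA) (hFlat) : ⟨UniformFibreGapOrbit, v11.4 text VERBATIM⟩` — prefix threaded as in part IX
  (`c₀ := min`, `pS := max`, `ε₁ := min`, `γ₁ := min` of the suppliers' constants and of lit ✓`exists_gamma_forall_θBal_le` at `σ := 2` for `(cw·b₀, p₀)`;
  `μ := min` of the three moduli — the body is monotone in `μ`, `gapBody_mono_mu`), each datum split by ✓part VIII `irr_or_caseA_or_loopHol_central`, the third
  stratum by §1 (`J < K`) ∕ §2 (`J = K`).  The Cruxes file is not importable here, so `argminHist` ∕ `ResidualGauge` ∕ the organ are SPELLED OUT (defs unfolded).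

HONEST: quantifier plumbing over landed letters; nothing of Bałaban's analysis; no constant is produced here; the two strata hypotheses ARE the (142)-with-rate ∕
Prop 7 content of [Balaban1985Variational] on the irreducible and case-A strata with a K-UNIFORM modulus ([Balaban1984PropagatorsII] (1.33)) — OPEN (the tree's
GAP♭ roads ✓px12∕✓px17∕✓px21 have `μ` AFTER the base point); the flat supplier at ALL depths is OPEN (depth one: px12 g22); `stub_uniformFibreGapOrbit` is NOT
closed by this file; TUBE-REG∘, EXW∘, DET-REP-B, S2β, crux 20520 OPEN; rung R3 (YM₃ on T³) is NOT d = 4, NOT infinite volume, NOT a mass gap, NOT Clay; the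
Yang–Mills mass gap is NOT proved.
-/

set_option autoImplicit false

noncomputable section

open Set Function
open scoped Matrix.Norms.L2Operator
open Literature.MathematicalPhysics.QuantumFieldTheory.Balaban1983to89
open Literature.MathematicalPhysics.QuantumFieldTheory.Balaban1983to89.T4Continuum
open Literature.MathematicalPhysics.QuantumFieldTheory.Balaban1983to89.B10Eq27TorusAxialLog (unitsField toUField)
open Literature.MathematicalPhysics.QuantumFieldTheory.Balaban1983to89.B9AdOrthogonal (σ₃)
open Literature.MathematicalPhysics.QuantumFieldTheory.Balaban1983to89.T3ContinuumYM3Torus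
open Literature.MathematicalPhysics.QuantumFieldTheory.Balaban1983to89.T3UnitLawDensityEML (ℰp)
open Literature.MathematicalPhysics.QuantumFieldTheory.Balaban1983to89.T3UnitScaleTilt
open Literature.MathematicalPhysics.QuantumFieldTheory.Balaban1983to89.T3TiltDescent
open Literature.MathematicalPhysics.QuantumFieldTheory.Balaban1983to89.T3Thresholds (exists_gamma_forall_θBal_le)
open Literature.MathematicalPhysics.QuantumFieldTheory.Balaban1983to89.T3ConstrainedMinimiser (fibre)
open Literature.MathematicalPhysics.QuantumFieldTheory.Balaban1983to89.T3DescentFibreTower (fibre_self)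
open Literature.MathematicalPhysics.QuantumFieldTheory.Balaban1983to89.T3PrintedRegularMinimiser
open Literature.MathematicalPhysics.QuantumFieldTheory.Balaban1983to89.T3PrintedRegularOrbits
open scoped Literature.MathematicalPhysics.QuantumFieldTheory.Balaban1983to89.T3OrbitAverage
open Literature.MathematicalPhysics.QuantumFieldTheory.Balaban1983to89.T3Thm1CarrierNative (IsCritR2)
open Literature.MathematicalPhysics.QuantumFieldTheory.Balaban1983to89.T4SmallFieldWindowSandwich (gaugeAct_const_one)
open Summit.QuantumFields.YangMills.Theorems.FluctuationComparisonRegPrIntLRegArgminFlat (regPr_of_flat plaqHol_eq_one_of_wilsonAction4_eq_zero')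
open Summit.QuantumFields.YangMills.Theorems.FluctuationComparisonRegPrIntLS2BetaSeamSectorMinimisers (isCritR2_of_eq_minActionRegPr)
open Summit.QuantumFields.YangMills.Theorems.FluctuationComparisonRegPrIntLS2BetaSeamSectorExactness (minActionRegPr_eq_zero_of_loopHol_central)
open Summit.QuantumFields.YangMills.Theorems.FluctuationComparisonRegPrIntLS2BetaWindowStrataCaseB (irr_or_caseA_or_loopHol_central)
open Summit.QuantumFields.YangMills.Theorems.FluctuationComparisonRegPrIntLS2BetaCaseBTransportPointwise (gapFlatAt_caseB_of_flat)

namespace Summit.QuantumFields.YangMills.Theorems.FluctuationComparisonRegPrIntLS2BetaGapOrbitOfStrata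

variable (F : T3Family) {J K : ℕ}

/-! ## §1 Part X's pointwise transport keyed on the registry's ARGMIN base-point binder -/

/-- ★ **AT A CASE-B `2`-SMALL DATUM, A FIBRE POINT WHOSE ACTION EQUALS PRINT'S REGULAR MINIMUM IS A MEMBER OF (6)(ε₀)** (`ε₀ > 0`): the regular minimum vanishes
there (✓part VII), so the point is flat, and a flat field is (6)-regular at every `ε₀ > 0` (✓`regPr_of_flat`). [cite: Balaban1985Variational, (2) p.278, (5)-(6) p.278, Thm 1 (8) p.279] -/
theorem mem_regFibrePr_of_eq_min_caseB (hJK : J ≤ K) {ε₀ : ℝ} (hε₀ : 0 < ε₀)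
    (V : GaugeField (F.P J) 0 (Matrix.specialUnitaryGroup (Fin 2) ℂ)) (x₀ : Site (F.P J) 0)
    (hcen : ∀ w : List (Letter (F.P J).d), walkEnd x₀ w = x₀ →
      ∀ M : Matrix (Fin 2) (Fin 2) ℂ, Commute ((holAt V (walk x₀ w) : Matrix.specialUnitaryGroup (Fin 2) ℂ) : Matrix (Fin 2) (Fin 2) ℂ) M)
    {δ : ℝ} (hδ : δ ≤ 2) (hV : PlaqSmall δ V)
    (U₀ : GaugeField (F.P K) 0 (Matrix.specialUnitaryGroup (Fin 2) ℂ)) (hU₀f : U₀ ∈ fibre F ℰp J K hJK V)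
    (hmin : wilsonAction4 U₀ = minActionRegPr F J K hJK ε₀ V) :
    U₀ ∈ regFibrePr F J K hJK ε₀ V := by
  have h0 : wilsonAction4 U₀ = 0 := by
    rw [hmin]
    exact minActionRegPr_eq_zero_of_loopHol_central F hJK hε₀ V x₀ hcen hδ hV
  exact (mem_regFibrePr_iff F).2 ⟨hU₀f, regPr_of_flat F hε₀ (plaqHol_eq_one_of_wilsonAction4_eq_zero' F U₀ h0)⟩

/-- ★★★★ **GAP♭-SHAPE: FROM THE FLAT DATUM TO EVERY CASE-B `(V, U₀)` WITH `U₀` AN ARGMIN BASE POINT, POINTWISE** — fixed `(F, γ, b₀, p₀, J, K, ε₀, c)`, `J < K`,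
`0 < ε₀`; `V` with central closed-walk holonomies and `PlaqSmall δ V`, `δ ≤ 2`; `U₀ ∈ fibre V` with `A(U₀) = minActionRegPr ε₀ V` (the registry's `argminHist`
binder; its `histGood` clause is not needed).  ✓part X `gapFlatAt_caseB_of_flat` ∘ §1 ∘ ✓`isCritR2_of_eq_minActionRegPr`.
[cite: Balaban1985Variational, (142) p.299, Prop. 7 p.299, (4)-(6) p.278; Balaban1984PropagatorsII, (1.33)] -/
theorem gapFlatAt_caseB_of_flat_atArgmin (hlt : J < K) {γ b₀ p₀ ε₀ : ℝ} (hε₀ : 0 < ε₀) (c : ℝ)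
    (h1 : (∀ U ∈ fibre F ℰp J K hlt.le (1 : GaugeField (F.P J) 0 (Matrix.specialUnitaryGroup (Fin 2) ℂ)), U ∈ histGood F ℰp (θBal F.L γ b₀ p₀) K J →
      c * ((F.L : ℝ)⁻¹) ^ (2 * (K - J)) *
        (⨅ w : {w : Site (F.P K) 0 → Matrix.specialUnitaryGroup (Fin 2) ℂ |
            ∀ U : GaugeField (F.P K) 0 (Matrix.specialUnitaryGroup (Fin 2) ℂ),
              descendTo F ℰp J K hlt.le (GaugeField.gaugeAct w U) = descendTo F ℰp J K hlt.le U},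
          ∑ ℓ : PBond (F.P K) 0,
            dist1 (U ℓ * ((GaugeField.gaugeAct (w : Site (F.P K) 0 → Matrix.specialUnitaryGroup (Fin 2) ℂ) (1 : GaugeField (F.P K) 0 (Matrix.specialUnitaryGroup (Fin 2) ℂ))) ℓ)⁻¹) ^ 2)
        ≤ wilsonAction4 U - minActionRegPr F J K hlt.le ε₀ (1 : GaugeField (F.P J) 0 (Matrix.specialUnitaryGroup (Fin 2) ℂ))))
    (V : GaugeField (F.P J) 0 (Matrix.specialUnitaryGroup (Fin 2) ℂ)) (x₀ : Site (F.P J) 0)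
    (hcen : ∀ w : List (Letter (F.P J).d), walkEnd x₀ w = x₀ →
      ∀ M : Matrix (Fin 2) (Fin 2) ℂ, Commute ((holAt V (walk x₀ w) : Matrix.specialUnitaryGroup (Fin 2) ℂ) : Matrix (Fin 2) (Fin 2) ℂ) M)
    {δ : ℝ} (hδ : δ ≤ 2) (hV : PlaqSmall δ V)
    (U₀ : GaugeField (F.P K) 0 (Matrix.specialUnitaryGroup (Fin 2) ℂ)) (hU₀f : U₀ ∈ fibre F ℰp J K hlt.le V)
    (hmin : wilsonAction4 U₀ = minActionRegPr F J K hlt.le ε₀ V) :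
    (∀ U ∈ fibre F ℰp J K hlt.le V, U ∈ histGood F ℰp (θBal F.L γ b₀ p₀) K J →
      c * ((F.L : ℝ)⁻¹) ^ (2 * (K - J)) *
        (⨅ w : {w : Site (F.P K) 0 → Matrix.specialUnitaryGroup (Fin 2) ℂ |
            ∀ U : GaugeField (F.P K) 0 (Matrix.specialUnitaryGroup (Fin 2) ℂ),
              descendTo F ℰp J K hlt.le (GaugeField.gaugeAct w U) = descendTo F ℰp J K hlt.le U},
          ∑ ℓ : PBond (F.P K) 0,
            dist1 (U ℓ * ((GaugeField.gaugeAct (w : Site (F.P K) 0 → Matrix.specialUnitaryGroup (Fin 2) ℂ) U₀) ℓ)⁻¹) ^ 2)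
        ≤ wilsonAction4 U - minActionRegPr F J K hlt.le ε₀ V) := by
  have hU₀ : U₀ ∈ regFibrePr F J K hlt.le ε₀ V := mem_regFibrePr_of_eq_min_caseB F hlt.le hε₀ V x₀ hcen hδ hV U₀ hU₀f hmin
  exact gapFlatAt_caseB_of_flat F hlt hε₀ c h1 V x₀ hcen hδ hV U₀ hU₀ (isCritR2_of_eq_minActionRegPr F hlt.le hε₀ V U₀ hU₀ hmin)

/-! ## §2 Depth zero -/

/-- **AT DEPTH ZERO THE GAP-BODY IS TRIVIAL AT EVERY DATUM AND EVERY ARGMIN BASE POINT** (any `c`): `fibre_{K,K}(V) = {V}` (lit ✓`fibre_self`), so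
`U = U₀ = V`; the orbit functional vanishes at `w ≡ 1` and `A(V) − minActionRegPr ε₀ V = A(V) − A(U₀) = 0`. [cite: Balaban1985UV3, (41) p.266; Balaban1985Variational, Thm 1 (8) p.279] -/
theorem gapAt_depthZero (K : ℕ) (hKK : K ≤ K) {γ b₀ p₀ ε₀ : ℝ} (c : ℝ)
    (V : GaugeField (F.P K) 0 (Matrix.specialUnitaryGroup (Fin 2) ℂ))
    (U₀ : GaugeField (F.P K) 0 (Matrix.specialUnitaryGroup (Fin 2) ℂ)) (hU₀f : U₀ ∈ fibre F ℰp K K hKK V)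
    (hmin : wilsonAction4 U₀ = minActionRegPr F K K hKK ε₀ V) :
    ∀ U ∈ fibre F ℰp K K hKK V, U ∈ histGood F ℰp (θBal F.L γ b₀ p₀) K K →
      c * ((F.L : ℝ)⁻¹) ^ (2 * (K - K)) *
        (⨅ w : {w : Site (F.P K) 0 → Matrix.specialUnitaryGroup (Fin 2) ℂ |
            ∀ U : GaugeField (F.P K) 0 (Matrix.specialUnitaryGroup (Fin 2) ℂ),
              descendTo F ℰp K K hKK (GaugeField.gaugeAct w U) = descendTo F ℰp K K hKK U},
          ∑ ℓ : PBond (F.P K) 0,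
            dist1 (U ℓ * ((GaugeField.gaugeAct (w : Site (F.P K) 0 → Matrix.specialUnitaryGroup (Fin 2) ℂ) U₀) ℓ)⁻¹) ^ 2)
        ≤ wilsonAction4 U - minActionRegPr F K K hKK ε₀ V := by
  intro U hU _
  have hUV : U = V := by
    have h := hU
    rw [fibre_self F ℰp K V] at h
    exact Set.mem_singleton_iff.mp h
  have hU₀V : U₀ = V := by
    have h := hU₀f
    rw [fibre_self F ℰp K V] at h
    exact Set.mem_singleton_iff.mp h
  have hAV : wilsonAction4 V = minActionRegPr F K K hKK ε₀ V := by
    have h := hmin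
    rw [hU₀V] at h
    exact h
  rw [hUV, hAV, sub_self, hU₀V]
  have hres : ∀ U' : GaugeField (F.P K) 0 (Matrix.specialUnitaryGroup (Fin 2) ℂ),
      descendTo F ℰp K K hKK (GaugeField.gaugeAct (fun _ => (1 : Matrix.specialUnitaryGroup (Fin 2) ℂ)) U') = descendTo F ℰp K K hKK U' := by
    intro U'
    rw [gaugeAct_const_one]
  have hle : (⨅ w : {w : Site (F.P K) 0 → Matrix.specialUnitaryGroup (Fin 2) ℂ |
            ∀ U : GaugeField (F.P K) 0 (Matrix.specialUnitaryGroup (Fin 2) ℂ),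
              descendTo F ℰp K K hKK (GaugeField.gaugeAct w U) = descendTo F ℰp K K hKK U},
          ∑ ℓ : PBond (F.P K) 0,
            dist1 (V ℓ * ((GaugeField.gaugeAct (w : Site (F.P K) 0 → Matrix.specialUnitaryGroup (Fin 2) ℂ) V) ℓ)⁻¹) ^ 2)
      ≤ ∑ ℓ : PBond (F.P K) 0,
          dist1 (V ℓ * ((GaugeField.gaugeAct (fun _ => (1 : Matrix.specialUnitaryGroup (Fin 2) ℂ)) V) ℓ)⁻¹) ^ 2 := by
    refine ciInf_le ⟨0, ?_⟩ (⟨fun _ => (1 : Matrix.specialUnitaryGroup (Fin 2) ℂ), hres⟩ :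
      {w : Site (F.P K) 0 → Matrix.specialUnitaryGroup (Fin 2) ℂ |
            ∀ U : GaugeField (F.P K) 0 (Matrix.specialUnitaryGroup (Fin 2) ℂ),
              descendTo F ℰp K K hKK (GaugeField.gaugeAct w U) = descendTo F ℰp K K hKK U})
    rintro _ ⟨w, rfl⟩
    exact Finset.sum_nonneg fun _ _ => sq_nonneg _
  have hval : ∑ ℓ : PBond (F.P K) 0,
      dist1 (V ℓ * ((GaugeField.gaugeAct (fun _ => (1 : Matrix.specialUnitaryGroup (Fin 2) ℂ)) V) ℓ)⁻¹) ^ 2 = 0 := by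
    rw [gaugeAct_const_one]
    refine Finset.sum_eq_zero fun ℓ _ => ?_
    rw [mul_inv_cancel, GaugeGroup.dist1_one, zero_pow two_ne_zero]
  have hinf : (⨅ w : {w : Site (F.P K) 0 → Matrix.specialUnitaryGroup (Fin 2) ℂ |
            ∀ U : GaugeField (F.P K) 0 (Matrix.specialUnitaryGroup (Fin 2) ℂ),
              descendTo F ℰp K K hKK (GaugeField.gaugeAct w U) = descendTo F ℰp K K hKK U},
          ∑ ℓ : PBond (F.P K) 0,
            dist1 (V ℓ * ((GaugeField.gaugeAct (w : Site (F.P K) 0 → Matrix.specialUnitaryGroup (Fin 2) ℂ) V) ℓ)⁻¹) ^ 2) = 0 :=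
    le_antisymm (hle.trans_eq hval) (Real.iInf_nonneg fun w => Finset.sum_nonneg fun _ _ => sq_nonneg _)
  rw [hinf, mul_zero]

/-! ## §3 The registered organ from its two analytic strata and the flat datum -/

/-- The GAP-body is MONOTONE in the modulus: a smaller `μ` is implied (the orbit functional is non-negative). [folklore] -/
theorem gapBody_mono_mu {μ μ' p I A : ℝ} (hμ : μ ≤ μ') (hp : 0 ≤ p) (hI : 0 ≤ I) (h : μ' * p * I ≤ A) : μ * p * I ≤ A :=
  (mul_le_mul_of_nonneg_right (mul_le_mul_of_nonneg_right hμ hp) hI).trans h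

/-- ★★★★ **`UniformFibreGapOrbit` (GAP♯∘, v11.4 text VERBATIM, `argminHist` ∕ `ResidualGauge` unfolded) ⟸ ITS RESTRICTIONS TO THE IRREDUCIBLE AND THE CASE-A STRATA
AND ITS BODY AT THE FLAT DATUM `(1, 1)` WITH `∃ μ` BEFORE `∀ F γ J K`** (hypotheses: the registered text with the guard «IRR(V)», resp. «case A′(V)», inserted after
the datum guard; and the flat supplier `∀ L, ∃ pS, ∀ b₀ p₀ …, ∃ ε₁, ∀ ε₀ ≤ ε₁, ∃ γ₁ μ > 0, ∀ F γ ≤ γ₁, ∀ J < K, ∀ U ∈ fibre(1) ∩ histGood, GAP-body(1, 1; μ)`).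
Case B is discharged by ✓part X's pointwise transport (§1) — the SAME `μ` — and depth zero by §2.
[cite: Balaban1985Variational, (142) p.299, Thm 1 (8)-(10) p.279, Prop. 7 p.299, (4)-(6) p.278; Balaban1984PropagatorsII, (1.33); Balaban1985UV3, (7) p.257] -/
theorem uniformFibreGapOrbit_of_strata_of_flat
    (hIrr : ∀ (L : ℕ), ∃ c₀ : ℝ, 0 < c₀ ∧ c₀ ≤ 1 ∧ ∀ (cw : ℝ), 0 < cw → cw ≤ c₀ → ∃ pS : ℝ, ∀ (b₀ p₀ : ℝ), 0 < b₀ → pS ≤ p₀ → 0 < p₀ → ∃ ε₁ : ℝ, 0 < ε₁ ∧ ∀ (ε₀ : ℝ), 0 < ε₀ → ε₀ ≤ ε₁ →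
    ∃ γ₁ : ℝ, 0 < γ₁ ∧ ∃ μ : ℝ, 0 < μ ∧ ∀ (F : T3Family) (γ : ℝ), F.L = L → 0 < γ → γ ≤ γ₁ →
      ∀ (J K : ℕ) (hJK : J ≤ K) (V : GaugeField (F.P J) 0 (Matrix.specialUnitaryGroup (Fin 2) ℂ)), PlaqSmall (θBal F.L γ (cw * b₀) p₀ J) V →
        (∀ c : Site (F.P J) 0 → Matrix (Fin 2) (Fin 2) ℂ,
          (∀ e : PBond (F.P J) 0, c e.src = ((unitsField (toUField V) e : (Matrix (Fin 2) (Fin 2) ℂ)ˣ) : Matrix (Fin 2) (Fin 2) ℂ) * c e.tgt *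
            (((unitsField (toUField V) e)⁻¹ : (Matrix (Fin 2) (Fin 2) ℂ)ˣ) : Matrix (Fin 2) (Fin 2) ℂ)) →
          ∃ z : ℂ, ∀ y, c y = z • (1 : Matrix (Fin 2) (Fin 2) ℂ)) →
        ∀ U₀ ∈ {U' : GaugeField (F.P K) 0 (Matrix.specialUnitaryGroup (Fin 2) ℂ) | U' ∈ fibre F ℰp J K hJK V ∧ U' ∈ histGood F ℰp (θBal F.L γ b₀ p₀) K J ∧
            wilsonAction4 U' = minActionRegPr F J K hJK ε₀ V},
        ∀ U ∈ fibre F ℰp J K hJK V, U ∈ histGood F ℰp (θBal F.L γ b₀ p₀) K J →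
          μ * ((F.L : ℝ)⁻¹) ^ (2 * (K - J)) *
              (⨅ w : {w : GaugeTransf (F.P K) 0 (Matrix.specialUnitaryGroup (Fin 2) ℂ) | ∀ U : GaugeField (F.P K) 0 (Matrix.specialUnitaryGroup (Fin 2) ℂ),
                  descendTo F ℰp J K hJK (GaugeField.gaugeAct w U) = descendTo F ℰp J K hJK U}, ∑ ℓ : PBond (F.P K) 0,
                dist1 (U ℓ * ((GaugeField.gaugeAct (w : GaugeTransf (F.P K) 0 (Matrix.specialUnitaryGroup (Fin 2) ℂ)) U₀) ℓ)⁻¹) ^ 2)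
            ≤ wilsonAction4 U - minActionRegPr F J K hJK ε₀ V)
    (hA : ∀ (L : ℕ), ∃ c₀ : ℝ, 0 < c₀ ∧ c₀ ≤ 1 ∧ ∀ (cw : ℝ), 0 < cw → cw ≤ c₀ → ∃ pS : ℝ, ∀ (b₀ p₀ : ℝ), 0 < b₀ → pS ≤ p₀ → 0 < p₀ → ∃ ε₁ : ℝ, 0 < ε₁ ∧ ∀ (ε₀ : ℝ), 0 < ε₀ → ε₀ ≤ ε₁ →
    ∃ γ₁ : ℝ, 0 < γ₁ ∧ ∃ μ : ℝ, 0 < μ ∧ ∀ (F : T3Family) (γ : ℝ), F.L = L → 0 < γ → γ ≤ γ₁ →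
      ∀ (J K : ℕ) (hJK : J ≤ K) (V : GaugeField (F.P J) 0 (Matrix.specialUnitaryGroup (Fin 2) ℂ)), PlaqSmall (θBal F.L γ (cw * b₀) p₀ J) V →
        (∃ g : GaugeTransf (F.P J) 0 (Matrix.specialUnitaryGroup (Fin 2) ℂ),
          (∀ e : PBond (F.P J) 0, Commute (((GaugeField.gaugeAct g V) e : Matrix.specialUnitaryGroup (Fin 2) ℂ) : Matrix (Fin 2) (Fin 2) ℂ) σ₃) ∧
          ∀ c : Site (F.P J) 0 → Matrix (Fin 2) (Fin 2) ℂ,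
            (∀ e : PBond (F.P J) 0, c e.src = ((unitsField (toUField (GaugeField.gaugeAct g V)) e : (Matrix (Fin 2) (Fin 2) ℂ)ˣ) : Matrix (Fin 2) (Fin 2) ℂ) * c e.tgt *
            (((unitsField (toUField (GaugeField.gaugeAct g V)) e)⁻¹ : (Matrix (Fin 2) (Fin 2) ℂ)ˣ) : Matrix (Fin 2) (Fin 2) ℂ)) →
            ∃ c₀ : Matrix (Fin 2) (Fin 2) ℂ, (∀ y, c y = c₀) ∧ Commute c₀ σ₃) →
        ∀ U₀ ∈ {U' : GaugeField (F.P K) 0 (Matrix.specialUnitaryGroup (Fin 2) ℂ) | U' ∈ fibre F ℰp J K hJK V ∧ U' ∈ histGood F ℰp (θBal F.L γ b₀ p₀) K J ∧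
            wilsonAction4 U' = minActionRegPr F J K hJK ε₀ V},
        ∀ U ∈ fibre F ℰp J K hJK V, U ∈ histGood F ℰp (θBal F.L γ b₀ p₀) K J →
          μ * ((F.L : ℝ)⁻¹) ^ (2 * (K - J)) *
              (⨅ w : {w : GaugeTransf (F.P K) 0 (Matrix.specialUnitaryGroup (Fin 2) ℂ) | ∀ U : GaugeField (F.P K) 0 (Matrix.specialUnitaryGroup (Fin 2) ℂ),
                  descendTo F ℰp J K hJK (GaugeField.gaugeAct w U) = descendTo F ℰp J K hJK U}, ∑ ℓ : PBond (F.P K) 0,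
                dist1 (U ℓ * ((GaugeField.gaugeAct (w : GaugeTransf (F.P K) 0 (Matrix.specialUnitaryGroup (Fin 2) ℂ)) U₀) ℓ)⁻¹) ^ 2)
            ≤ wilsonAction4 U - minActionRegPr F J K hJK ε₀ V)
    (hFlat : ∀ (L : ℕ), ∃ pS : ℝ, ∀ (b₀ p₀ : ℝ), 0 < b₀ → pS ≤ p₀ → 0 < p₀ → ∃ ε₁ : ℝ, 0 < ε₁ ∧ ∀ (ε₀ : ℝ), 0 < ε₀ → ε₀ ≤ ε₁ →
    ∃ γ₁ : ℝ, 0 < γ₁ ∧ ∃ μ : ℝ, 0 < μ ∧ ∀ (F : T3Family) (γ : ℝ), F.L = L → 0 < γ → γ ≤ γ₁ →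
      ∀ (J K : ℕ) (hlt : J < K),
        ∀ U ∈ fibre F ℰp J K hlt.le (1 : GaugeField (F.P J) 0 (Matrix.specialUnitaryGroup (Fin 2) ℂ)), U ∈ histGood F ℰp (θBal F.L γ b₀ p₀) K J →
          μ * ((F.L : ℝ)⁻¹) ^ (2 * (K - J)) *
              (⨅ w : {w : Site (F.P K) 0 → Matrix.specialUnitaryGroup (Fin 2) ℂ |
                  ∀ U : GaugeField (F.P K) 0 (Matrix.specialUnitaryGroup (Fin 2) ℂ),
                    descendTo F ℰp J K hlt.le (GaugeField.gaugeAct w U) = descendTo F ℰp J K hlt.le U},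
                ∑ ℓ : PBond (F.P K) 0,
                  dist1 (U ℓ * ((GaugeField.gaugeAct (w : Site (F.P K) 0 → Matrix.specialUnitaryGroup (Fin 2) ℂ) (1 : GaugeField (F.P K) 0 (Matrix.specialUnitaryGroup (Fin 2) ℂ))) ℓ)⁻¹) ^ 2)
            ≤ wilsonAction4 U - minActionRegPr F J K hlt.le ε₀ (1 : GaugeField (F.P J) 0 (Matrix.specialUnitaryGroup (Fin 2) ℂ))) :
    ∀ (L : ℕ), ∃ c₀ : ℝ, 0 < c₀ ∧ c₀ ≤ 1 ∧ ∀ (cw : ℝ), 0 < cw → cw ≤ c₀ → ∃ pS : ℝ, ∀ (b₀ p₀ : ℝ), 0 < b₀ → pS ≤ p₀ → 0 < p₀ → ∃ ε₁ : ℝ, 0 < ε₁ ∧ ∀ (ε₀ : ℝ), 0 < ε₀ → ε₀ ≤ ε₁ →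
    ∃ γ₁ : ℝ, 0 < γ₁ ∧ ∃ μ : ℝ, 0 < μ ∧ ∀ (F : T3Family) (γ : ℝ), F.L = L → 0 < γ → γ ≤ γ₁ →
      ∀ (J K : ℕ) (hJK : J ≤ K) (V : GaugeField (F.P J) 0 (Matrix.specialUnitaryGroup (Fin 2) ℂ)), PlaqSmall (θBal F.L γ (cw * b₀) p₀ J) V →
        ∀ U₀ ∈ {U' : GaugeField (F.P K) 0 (Matrix.specialUnitaryGroup (Fin 2) ℂ) | U' ∈ fibre F ℰp J K hJK V ∧ U' ∈ histGood F ℰp (θBal F.L γ b₀ p₀) K J ∧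
            wilsonAction4 U' = minActionRegPr F J K hJK ε₀ V},
        ∀ U ∈ fibre F ℰp J K hJK V, U ∈ histGood F ℰp (θBal F.L γ b₀ p₀) K J →
          μ * ((F.L : ℝ)⁻¹) ^ (2 * (K - J)) *
              (⨅ w : {w : GaugeTransf (F.P K) 0 (Matrix.specialUnitaryGroup (Fin 2) ℂ) | ∀ U : GaugeField (F.P K) 0 (Matrix.specialUnitaryGroup (Fin 2) ℂ),
                  descendTo F ℰp J K hJK (GaugeField.gaugeAct w U) = descendTo F ℰp J K hJK U}, ∑ ℓ : PBond (F.P K) 0,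
                dist1 (U ℓ * ((GaugeField.gaugeAct (w : GaugeTransf (F.P K) 0 (Matrix.specialUnitaryGroup (Fin 2) ℂ)) U₀) ℓ)⁻¹) ^ 2)
            ≤ wilsonAction4 U - minActionRegPr F J K hJK ε₀ V := by
  intro L
  obtain ⟨c₁, hc₁, hc₁1, H1⟩ := hIrr L
  obtain ⟨c₂, hc₂, -, H2⟩ := hA L
  obtain ⟨pS₃, H3⟩ := hFlat L
  refine ⟨min c₁ c₂, lt_min hc₁ hc₂, (min_le_left _ _).trans hc₁1, ?_⟩
  intro cw hcw hcwle
  obtain ⟨pS₁, H1⟩ := H1 cw hcw (hcwle.trans (min_le_left _ _))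
  obtain ⟨pS₂, H2⟩ := H2 cw hcw (hcwle.trans (min_le_right _ _))
  refine ⟨max pS₁ (max pS₂ pS₃), ?_⟩
  intro b₀ p₀ hb hpS hp
  obtain ⟨e₁, he₁, H1⟩ := H1 b₀ p₀ hb ((le_max_left _ _).trans hpS) hp
  obtain ⟨e₂, he₂, H2⟩ := H2 b₀ p₀ hb (((le_max_left _ _).trans (le_max_right _ _)).trans hpS) hp
  obtain ⟨e₃, he₃, H3⟩ := H3 b₀ p₀ hb (((le_max_right _ _).trans (le_max_right _ _)).trans hpS) hp
  refine ⟨min e₁ (min e₂ e₃), lt_min he₁ (lt_min he₂ he₃), ?_⟩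
  intro ε₀ hε₀ hε₀le
  obtain ⟨γa, hγa, μa, hμa, H1⟩ := H1 ε₀ hε₀ (hε₀le.trans (min_le_left _ _))
  obtain ⟨γb, hγb, μb, hμb, H2⟩ := H2 ε₀ hε₀ (hε₀le.trans ((min_le_right _ _).trans (min_le_left _ _)))
  obtain ⟨γf, hγf, μf, hμf, H3⟩ := H3 ε₀ hε₀ (hε₀le.trans ((min_le_right _ _).trans (min_le_right _ _)))
  obtain ⟨γc, hγc, hγc1, hθ⟩ := exists_gamma_forall_θBal_le (b₀ := cw * b₀) (p₀ := p₀) (mul_pos hcw hb) hp (σ := 2) two_pos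
  refine ⟨min γa (min γb (min γf γc)), lt_min hγa (lt_min hγb (lt_min hγf hγc)), min μa (min μb μf), lt_min hμa (lt_min hμb hμf), ?_⟩
  intro F γ hFL hγ hγle J K hJK V hV U₀ hU₀ U hU hUg
  have hp0 : (0 : ℝ) ≤ ((F.L : ℝ)⁻¹) ^ (2 * (K - J)) := pow_nonneg (inv_nonneg.mpr (Nat.cast_nonneg _)) _
  have hI0 : (0 : ℝ) ≤ (⨅ w : {w : GaugeTransf (F.P K) 0 (Matrix.specialUnitaryGroup (Fin 2) ℂ) | ∀ U : GaugeField (F.P K) 0 (Matrix.specialUnitaryGroup (Fin 2) ℂ),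
                  descendTo F ℰp J K hJK (GaugeField.gaugeAct w U) = descendTo F ℰp J K hJK U}, ∑ ℓ : PBond (F.P K) 0,
                dist1 (U ℓ * ((GaugeField.gaugeAct (w : GaugeTransf (F.P K) 0 (Matrix.specialUnitaryGroup (Fin 2) ℂ)) U₀) ℓ)⁻¹) ^ 2) :=
    Real.iInf_nonneg fun w => Finset.sum_nonneg fun _ _ => sq_nonneg _
  rcases irr_or_caseA_or_loopHol_central V with hirr | hcA | ⟨x₀, hcen⟩
  · exact gapBody_mono_mu (min_le_left _ _) hp0 hI0
      (H1 F γ hFL hγ (hγle.trans (min_le_left _ _)) J K hJK V hV hirr U₀ hU₀ U hU hUg)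
  · exact gapBody_mono_mu ((min_le_right _ _).trans (min_le_left _ _)) hp0 hI0
      (H2 F γ hFL hγ (hγle.trans ((min_le_right _ _).trans (min_le_left _ _))) J K hJK V hV hcA U₀ hU₀ U hU hUg)
  · rcases Nat.eq_or_lt_of_le hJK with hJKeq | hlt
    · subst hJKeq
      exact gapAt_depthZero F J hJK _ V U₀ hU₀.1 hU₀.2.2 U hU hUg
    · have hγc' : γ ≤ γc := hγle.trans ((min_le_right _ _).trans ((min_le_right _ _).trans (min_le_right _ _)))
      have hL : 1 ≤ F.L := F.hL.2.le
      have h2 : θBal F.L γ (cw * b₀) p₀ J ≤ 2 := hθ F.L hL γ hγ hγc' J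
      exact gapBody_mono_mu ((min_le_right _ _).trans (min_le_right _ _)) hp0 hI0
        (gapFlatAt_caseB_of_flat_atArgmin F hlt hε₀ μf
          (H3 F γ hFL hγ (hγle.trans ((min_le_right _ _).trans ((min_le_right _ _).trans (min_le_left _ _)))) J K hlt)
          V x₀ hcen h2 hV U₀ hU₀.1 hU₀.2.2 U hU hUg)

end Summit.QuantumFields.YangMills.Theorems.FluctuationComparisonRegPrIntLS2BetaGapOrbitOfStrata

end
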